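import Summits.CriticalPhenomena.SAWScalingLimit.Theses.SAWDevelopingMap
import Summits.CriticalPhenomena.SAWScalingLimit.Theorems.ObservableToSLE.Negative.Identification
import Literature.Probability.RandomPlanarGeometry.HullRestrictionTests
import Literature.Probability.RandomPlanarGeometry.HullSubdomainPullback
import Literature.Probability.RandomPlanarGeometry.ConformalRectangle
import Literature.Probability.RandomPlanarGeometry.RestrictionHulls
import HarnessLib.Audit

/-!
# Line `floor-ratio-restriction-bootstrap` — crux `SAWDevelopingMap.ObservableToSLE`
(stmt-CriticalPhenomena-10472; shared by routes SAWDevelopingMap, SAWResidueField,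
SAWDefectDecoherence, SAWWindingAlias, SAWPhaseRetrieval)

Skeleton (crux-plan, round 1) of the idea card `Ideas/floor-ratio-restriction-bootstrap.md`
(ideator 2), merged by the triage panel with `coalescent-arc-restriction` and
`target-transport-short-chord` (same lever), sharpened as the panel asked (dichotomy dropped, the
constant is fixed by coalescence at the source; the anchor stated as THE half-plane arch-locality
stub; W2 = boundary-class / endpoint extension isolated as one explicit stub).

THE LINE.  The crux is, by the landed Negative lemma
`Theorems.ObservableToSLE.Negative.observableToSLE_iff_identification` (p69742), exactly
`HexObservableLimit → HexTight → (every subsequential limit law of the critical hexagonal SAW in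
(D; a, b) is the chordal SLE(8/3) law)`.  The line identifies the limit laws WITHOUT a slit domain,
a Loewner chain or a driving process (W1, W3, W4 of CruxAttack10472 / Disproof.lean never arise):

1. `stub_targetTransport` (S1, soft): two instances of `HexObservableLimit` with the same
   discretisation and bulk bump but two flat normalisation points `b`, `b'` divide to
   `F_δ(b'_δ)/F_δ(b_δ) → exp((5/8)(L_{b'} − L_b))` (`FloorRatioLimit`).
2. `stub_shortChordLocality` (ANCHOR, the one SAW a-priori estimate): critical half-plane arches
   between floor points at distance `n` reach distance `K n` with `x_c`-mass fraction `≤ ε(K) → 0`,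
   uniformly in `n` and in floor-supported lattice domains containing the half-box `B⁺(2Kn)`.
3. `stub_restrictionCocycle` (S2): exact restriction `Z_{Λ'}/Z_Λ = P_Λ(γ ⊆ Λ')`, target transport
   at `b` and at a floor point `s → a` in `Λ` and `Λ'`, and short-chord locality at the source give
   `Z_{Λ'_δ}(a,b)/Z_{Λ_δ}(a,b) → Φ'_A(0)^{5/8}` for admissible discretisations of a FLOOR domain `D`
   (Jordan, `D ⊆ {im > h}`, both marked points on `{im = h}`, flat half-discs there) and of any hull
   subdomain `D' = φ(ℍ ∖ A)` — the Lawler–Schramm–Werner value ([LSW03] Thm 6.1, [LSW04] Prop. 2).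
4. `stub_canonicalTransfer`: the same limit for the canonical `hexSAWLaw` of `HexSAW.lean`
   (largest mesh component, closed-segment edges) with floor-vertex endpoints (hole filling,
   pendant rows, δ-collar avoidance from the cocycle itself).
5. `stub_chordalCarrier` (range → curve): subsequential limits in the floor class are carried by
   `chordalCarrier D` (simple, from `a` to `b`, inside `D ∪ {a,b}`); boundary avoidance follows from
   the restriction limits, SIMPLICITY is the open part (no ε-parallel macroscopic double strand).
6. `stub_restrictionIdentifies` (LSW closing, tree glue): a subsequential limit law carried by the
   chordal carrier whose lattice hull-avoidance probabilities tend to `Φ'_A(0)^{5/8}` for every hull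
   subdomain is `IsSLELaw (8/3) D` (portmanteau sandwich + kernel continuity of `Φ'_·(0)` +
   `CurveClass.Measure.ext_of_missCode_injOn` / `injOn_missCode_imageTest` + [LSW] Thm 6.1
   transposed, all in the tree).
7. `stub_domainExtension` (W2, the shared residue of every line on this crux): identification for
   the floor class with floor-vertex endpoints ⟹ identification for every Dobrushin domain and
   every `IsEmbEndpointApprox`.  Honest: no mechanism of this line reaches it (outside the floor
   class the monotone reduction of the anchor lands on bulk critical two-point masses, whose
   finiteness in 2D is not in print); recommended for promotion to a route item.

Composition (sorry-free): `floorIdentification_of_parts`, `ObservableToSLE_of` (concludes the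
crux BY NAME through `observableToSLE_iff_identification.mpr`).

LEAD RESHAPE (prover-line-stmt-CriticalPhenomena-10472-0, 2026-08-16, rev-4 repair).  The planner's
skeleton (commit eead1a5a399f) was typed against the PRE-rev-4 `HexObservableLimit` (root tied to
`pt 0` only Euclideanly).  Since 2026-08-16T00:03Z the antecedent is the repaired item
stmt-CriticalPhenomena-14003 (flat floor + exact half-lattice rows at BOTH marked points,
`m : Fin 2 → ℝ → ℤ`).  `FloorRatioLimit` as originally typed (no clause at `pt 0`) is FALSE by the
landed corridor witness (`BoundaryClosureNegative_*`: on the upper half-disc the body family, root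
`→ 1/2`, and the body-plus-corridor family, root `→ 3/4`, have identical ratio sequences
`F_δ(b'_δ)/F_δ(b_δ)` by corridor peeling, while the predicted limits
`(Φ_r'(b')/Φ_r'(0))^{5/8}`, `Φ_r(z) = (1-r)²z/((r-z)(1-rz))`, differ — e.g. `240/729` vs
`135/361` before the power at `b' = -1/4`), so `TargetTransport` would have been
`¬ HexObservableLimit` in disguise.  Repair: `FloorRatioLimit` now carries flatness of `D` at
`pt 0` and the exact-row clause in `ball (pt 0) ρ` (row function `m₀`); it is then two instances
of the repaired hypothesis, and its only consumer `stub_restrictionCocycle` applies it inside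
`IsFloorDomain` with rigid rows in both balls (second point `s ∈ B(a, ρ)`, radius `ρ − |s − a|`),
so the composition is unchanged.  Stub names and the other six signatures are unchanged.

Disproof.lean (cdisprove gen 2, v4e) honoured: `conclusion_false_without_reachable/_tendsto` —
the endpoint-approximation fields are used (stub 4, 6, 7 take `IsEmbEndpointApprox`);
`slitDisc_ne_carrier` / `carrier_ne_of_cutPoint` (W1) — no slit domain is ever a `DobrushinDomain`
here, every hull subdomain is Jordan; `flat_premise_false_on_unitDisc` (W2) — the hypothesis is
used only on floor domains (flat at both marked points), the disc is reached only through stub 7;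
`itoDrift_eq_zero_iff` (W4) — no Itô calculus; `observableToSLE_iff_identification` — IS the glue.
Negatives index (stmt-0772 all-δ tightness; 8312/8261): untouched (only the eventual `HexTight`).
-/

noncomputable section

open scoped BigOperators Topology NNReal ENNReal Classical
open Filter Set MeasureTheory Metric
open Literature.Probability.LatticeModels (HexVertex hexGraph hexCenter)
open Literature.Probability.RandomPlanarGeometry
open Literature.Probability.RandomPlanarGeometry.SAW
open UpperHalfPlane (upperHalfPlaneSet)

namespace Summit.CriticalPhenomena.SAWScalingLimit.Cruxes.ObservableToSLE.FloorRatioRestrictionBootstrap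

open Summit.CriticalPhenomena.SAWScalingLimit.Theses.SAWDevelopingMap (HexObservableLimit HexTight)

/-! ## Vocabulary of the line (floor class, partition functions, the typed intermediate statements) -/

/-- The critical boundary partition function `Z_Λ(a → z) = Σ_{γ ⊂ Ω : a → z} x_c^{ℓ(γ)}` between two
mid-edges of the hexagonal domain with vertex set `Λ` (= the spin-`0` observable,
`hexParafermionicObservable_zero_spin`). -/
def Z (Λ : Finset HexVertex) (a z : Sym2 HexVertex) : ℝ :=
  ∑ γ : HexMidEdgeSAW Λ a z, hexCriticalFugacity ^ γ.length

/-- **Floor domain at scale `ρ`**: a Dobrushin domain `(D; a, b)` lying above the horizontal line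
through its two marked points (`im a = im b = h`, `D ⊆ {im > h}`) and FLAT near both of them
(inside `B(a, ρ)` and `B(b, ρ)` it is the open upper half-disc).  Discretised honestly this is the
setting of [LSW03] (`ℍ` minus hulls); `HexObservableLimit` applies to it (flat at `pt 1`) and to
every re-marking of it at another floor point.  Downward closed in `ρ`. -/
def IsFloorDomain (D : DobrushinDomain) (ρ : ℝ) : Prop :=
  0 < ρ ∧ (D.pt 1).im = (D.pt 0).im ∧ D.carrier ⊆ {z : ℂ | (D.pt 0).im < z.im} ∧
    D.carrier ∩ ball (D.pt 0) ρ = {z : ℂ | (D.pt 0).im < z.im} ∩ ball (D.pt 0) ρ ∧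
    D.carrier ∩ ball (D.pt 1) ρ = {z : ℂ | (D.pt 1).im < z.im} ∩ ball (D.pt 1) ρ

/-- **Floor-vertex endpoint approximation**: an endpoint approximation (`IsEmbEndpointApprox`:
joined in `Ω_δ`, `δ a_δ → a`, `δ b_δ → b`) whose lattice endpoints sit ON the floor — each has a
honeycomb neighbour on or below the floor line, i.e. it is the inner vertex of a vertical
boundary mid-edge of the bottom zigzag row (the class the mid-edge observable speaks about).
Satisfiable for every floor domain (take the floor vertex nearest to `a`, resp. `b`). -/
def IsFloorEndpointApprox (D : DobrushinDomain) (a b : ℝ → HexVertex) : Prop :=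
  IsEmbEndpointApprox hexGraph hexCenter D a b ∧
    ∀ᶠ δ : ℝ in 𝓝[>] 0,
      (∃ u : HexVertex, hexGraph.Adj (a δ) u ∧ ((δ : ℂ) * hexCenter u).im ≤ (D.pt 0).im) ∧
      (∃ u : HexVertex, hexGraph.Adj (b δ) u ∧ ((δ : ℂ) * hexCenter u).im ≤ (D.pt 1).im)

/-- **S1 — the floor-ratio limit (target transport); rev-4 form (lead's reshape, 2026-08-16).**
Same quantifier shape as the REPAIRED `HexObservableLimit` (item stmt-CriticalPhenomena-14003:
root pinned conformally), with TWO normalisation mid-edges `b δ → D.pt 1` and `b' δ → D'.pt 1` on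
two flat horizontal pieces (domain above; row thresholds `m δ`, `m' δ`), the ROOT `a δ → D.pt 0`
also on a flat horizontal piece with exact half-lattice rows `≥ m₀ δ` in `B(pt 0, ρ)` (the two
clauses the pre-rev-4 typing lacked — without them the statement is FALSE by the landed corridor
witness of `SAWDefectDecoherenceHexObservableLimit_refuted`: body/corridor families on the half-disc
give identical ratio sequences with different predicted limits), `D'` a re-marking of the same
Jordan domain with the same source (`D'.carrier = D.carrier`, `D'.pt 0 = D.pt 0`), one map
`Φ : D → ℍ` (`a ↦ ∞`, `b ↦ 0`) and one continuous logarithm `L` of `Φ'` with limits `Lb`, `Lb'` at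
the two points.  Conclusion: `F_δ(b'_δ)/F_δ(b_δ) → exp((5/8)(Lb' − Lb))`; taking moduli (the
winding to a floor exit is deterministic, `|F_δ(p)| = Z_δ(a → p)`) this is
`Z_δ(a→b')/Z_δ(a→b) → |Φ'(b')/Φ'(b)|^{5/8}`.  Derivation: two instances of `HexObservableLimit`
with `m := ![m₀, m]` resp. `![m₀, m']`, the second for `D'` with `Φ − Φ(b')` (`Φ(b') ∈ ℝ` exists
because `L → Lb'` bounds `Φ'` on the convex half-disc at `b'`), the same `L`, one bump `ψ` with
`∫ ψ e^{(5/8)L} ≠ 0`, divided (`c ≠ 0`). -/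
def FloorRatioLimit : Prop :=
  ∀ (D D' : DobrushinDomain) (ρ : ℝ) (Λ : ℝ → Finset HexVertex) (m₀ m m' : ℝ → ℤ)
    (a b b' : ℝ → Sym2 HexVertex) (Φ : ConformalEquiv D.carrier upperHalfPlaneSet)
    (L : ℂ → ℂ) (Lb Lb' : ℂ),
    let F : ℝ → Sym2 HexVertex → ℂ := fun δ z =>
      hexParafermionicObservable (Λ δ) (a δ) hexCriticalFugacity (5 / 8) z
    D'.carrier = D.carrier → D'.pt 0 = D.pt 0 → 0 < ρ →
    D.carrier ∩ ball (D.pt 0) ρ = {z : ℂ | (D.pt 0).im < z.im} ∩ ball (D.pt 0) ρ →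
    D.carrier ∩ ball (D.pt 1) ρ = {z : ℂ | (D.pt 1).im < z.im} ∩ ball (D.pt 1) ρ →
    D.carrier ∩ ball (D'.pt 1) ρ = {z : ℂ | (D'.pt 1).im < z.im} ∩ ball (D'.pt 1) ρ →
    (∀ᶠ δ : ℝ in 𝓝[>] 0,
      hexDomainSimplyConnected (Λ δ) ∧ a δ ∈ hexDomainBoundary (Λ δ) ∧
      b δ ∈ hexDomainBoundary (Λ δ) ∧ b' δ ∈ hexDomainBoundary (Λ δ) ∧
      Nonempty (HexMidEdgeSAW (Λ δ) (a δ) (b δ)) ∧ Nonempty (HexMidEdgeSAW (Λ δ) (a δ) (b' δ)) ∧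
      (hexGraph.induce (↑(Λ δ) : Set HexVertex)).Preconnected ∧
      (∀ v ∈ Λ δ, (δ : ℂ) * hexCenter v ∈ D.carrier) ∧
      (∀ v : HexVertex, (δ : ℂ) * hexCenter v ∈ ball (D.pt 0) ρ → (v ∈ Λ δ ↔ m₀ δ ≤ v.1 1)) ∧
      (∀ v : HexVertex, (δ : ℂ) * hexCenter v ∈ ball (D.pt 1) ρ → (v ∈ Λ δ ↔ m δ ≤ v.1 1)) ∧
      (∀ v : HexVertex, (δ : ℂ) * hexCenter v ∈ ball (D'.pt 1) ρ → (v ∈ Λ δ ↔ m' δ ≤ v.1 1))) →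
    (∀ K : Set ℂ, IsCompact K → K ⊆ D.carrier →
      ∀ᶠ δ : ℝ in 𝓝[>] 0, ∀ v : HexVertex, (δ : ℂ) * hexCenter v ∈ K → v ∈ Λ δ) →
    Tendsto (fun δ : ℝ => (δ : ℂ) * hexMidpoint (a δ)) (𝓝[>] 0) (𝓝 (D.pt 0)) →
    Tendsto (fun δ : ℝ => (δ : ℂ) * hexMidpoint (b δ)) (𝓝[>] 0) (𝓝 (D.pt 1)) →
    Tendsto (fun δ : ℝ => (δ : ℂ) * hexMidpoint (b' δ)) (𝓝[>] 0) (𝓝 (D'.pt 1)) →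
    Tendsto (fun x => ‖Φ x‖) (𝓝[D.carrier] (D.pt 0)) atTop →
    Φ.HasBoundaryValue (D.pt 1) 0 →
    ContinuousOn L D.carrier → (∀ z ∈ D.carrier, Complex.exp (L z) = deriv Φ z) →
    Tendsto L (𝓝[D.carrier] (D.pt 1)) (𝓝 Lb) → Tendsto L (𝓝[D.carrier] (D'.pt 1)) (𝓝 Lb') →
    Tendsto (fun δ : ℝ => F δ (b' δ) / F δ (b δ)) (𝓝[>] 0)
      (𝓝 (Complex.exp ((5 / 8 : ℂ) * (Lb' - Lb))))

/-- **STUB 1 statement**: target transport is a consequence of the crux's own hypothesis. -/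
def TargetTransport : Prop :=
  HexObservableLimit → FloorRatioLimit

/-- **STUB 2 statement — SHORT-CHORD LOCALITY (the anchor; ideator-2 typing, triage-verified
non-degenerate).**  Lattice units: `s, t` are floor mid-edges at mutual distance `≤ n` on the bottom
row of a simply connected domain `Λ` lying ABOVE that row and containing the whole upper half-box
of radius `2Kn` around `s`; then the `x_c`-mass of walks `s → t` having a vertex at distance `≥ K n`
from `s` is at most `ε` times the total mass.  By monotonicity in the domain (numerator ≤ half-plane
mass, denominator ≥ half-box mass) this is a statement about critical HALF-PLANE ARCHES only;
`n` small is the tail of the convergent arch series (DCS Lemma 2, tree), the content is uniformity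
in `n` — a boundary two-arm / arch-tightness estimate (RSW species, no FKG). -/
def ShortChordLocality : Prop :=
  ∀ ε : ℝ, 0 < ε → ∃ K : ℝ, 0 < K ∧ ∀ (n : ℕ), 1 ≤ n → ∀ (Λ : Finset HexVertex)
    (s t : Sym2 HexVertex), hexDomainSimplyConnected Λ →
    s ∈ hexDomainBoundary Λ → t ∈ hexDomainBoundary Λ → s ≠ t →
    dist (hexMidpoint s) (hexMidpoint t) ≤ n →
    (hexMidpoint t).im = (hexMidpoint s).im →
    (∀ v ∈ Λ, (hexMidpoint s).im < (hexCenter v).im) →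
    (∀ v : HexVertex, (hexMidpoint s).im < (hexCenter v).im →
      dist (hexCenter v) (hexMidpoint s) ≤ 2 * K * n → v ∈ Λ) →
    (∑ γ : HexMidEdgeSAW Λ s t,
        if ∃ v ∈ γ.verts, K * n ≤ dist (hexCenter v) (hexMidpoint s)
        then hexCriticalFugacity ^ γ.length else 0) ≤
      ε * ∑ γ : HexMidEdgeSAW Λ s t, hexCriticalFugacity ^ γ.length

/-- **The restriction cocycle limit in the ADMISSIBLE world** (the world of `HexObservableLimit`:
vertex-set domains `Λ δ` with all honeycomb edges between their vertices, mid-edge walks).  For a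
floor domain `(D; a, b)` at scale `ρ`, a hull subdomain `D'` (Jordan, `D ∖ D'` away from `a, b`), a
chordal uniformizing map `φ : (ℍ; 0, ∞) → (D; a, b)`, the pulled-back `*`-hull
`A = closure (ℍ ∖ φ⁻¹ D')` with restriction map `Φ_A` and `Φ'_A(0) = d`, and admissible families
`Λ' δ ⊆ Λ δ` for `D' ⊆ D` (simply connected, connected, `Λ` above the floor row `m δ`, both equal to
the rows `≥ m δ` inside the two balls, exhausting the compacts of `D` resp. `D'`) with common floor
boundary mid-edges `a δ → a`, `b δ → b`: the exact lattice restriction probability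
`P^{Λ_δ}(γ ⊆ Λ'_δ) = Z_{Λ'_δ}(a,b)/Z_{Λ_δ}(a,b)` tends to `Φ'_A(0)^{5/8}` ([LSW04] Prop. 2 /
[LSW03] Thm 6.1 is the matching SLE(8/3) statement, `sle_restriction_eightThirds`). -/
def AdmissibleRestrictionLimit : Prop :=
  ∀ (D D' : DobrushinDomain) (ρ : ℝ) (φ : ConformalEquiv upperHalfPlaneSet D.carrier)
    (Φ : ConformalEquiv (upperHalfPlaneSet \ φ.pullbackHull D') upperHalfPlaneSet) (d : ℝ)
    (Λ Λ' : ℝ → Finset HexVertex) (m : ℝ → ℤ) (a b : ℝ → Sym2 HexVertex),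
    IsFloorDomain D ρ → D.IsHullSubdomain D' → D.IsChordalUniformizing φ →
    IsRestrictionMap (φ.pullbackHull D') Φ → HasRestrictionDeriv (φ.pullbackHull D') Φ d →
    (∀ᶠ δ : ℝ in 𝓝[>] 0,
      Λ' δ ⊆ Λ δ ∧ hexDomainSimplyConnected (Λ δ) ∧ hexDomainSimplyConnected (Λ' δ) ∧
      (hexGraph.induce (↑(Λ δ) : Set HexVertex)).Preconnected ∧
      (hexGraph.induce (↑(Λ' δ) : Set HexVertex)).Preconnected ∧
      a δ ∈ hexDomainBoundary (Λ δ) ∧ b δ ∈ hexDomainBoundary (Λ δ) ∧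
      a δ ∈ hexDomainBoundary (Λ' δ) ∧ b δ ∈ hexDomainBoundary (Λ' δ) ∧
      Nonempty (HexMidEdgeSAW (Λ' δ) (a δ) (b δ)) ∧
      (∀ v ∈ Λ δ, (δ : ℂ) * hexCenter v ∈ D.carrier ∧ m δ ≤ v.1 1) ∧
      (∀ v ∈ Λ' δ, (δ : ℂ) * hexCenter v ∈ D'.carrier) ∧
      (∀ v : HexVertex, (δ : ℂ) * hexCenter v ∈ ball (D.pt 0) ρ ∪ ball (D.pt 1) ρ →
        ((v ∈ Λ δ ↔ m δ ≤ v.1 1) ∧ (v ∈ Λ' δ ↔ m δ ≤ v.1 1)))) →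
    (∀ K : Set ℂ, IsCompact K → K ⊆ D.carrier →
      ∀ᶠ δ : ℝ in 𝓝[>] 0, ∀ v : HexVertex, (δ : ℂ) * hexCenter v ∈ K → v ∈ Λ δ) →
    (∀ K : Set ℂ, IsCompact K → K ⊆ D'.carrier →
      ∀ᶠ δ : ℝ in 𝓝[>] 0, ∀ v : HexVertex, (δ : ℂ) * hexCenter v ∈ K → v ∈ Λ' δ) →
    Tendsto (fun δ : ℝ => (δ : ℂ) * hexMidpoint (a δ)) (𝓝[>] 0) (𝓝 (D.pt 0)) →
    Tendsto (fun δ : ℝ => (δ : ℂ) * hexMidpoint (b δ)) (𝓝[>] 0) (𝓝 (D.pt 1)) →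
    Tendsto (fun δ : ℝ => Z (Λ' δ) (a δ) (b δ) / Z (Λ δ) (a δ) (b δ)) (𝓝[>] 0)
      (𝓝 (d ^ ((5 : ℝ) / 8)))

/-- **STUB 3 statement**: the crux hypothesis (consumed through target transport, stub 1) +
short-chord locality ⟹ the restriction cocycle.  (Lead, 2026-08-16: the antecedent is
`HexObservableLimit` rather than `FloorRatioLimit` only so that the registered, fully unfolded stub
signature stays under the registry's size bound; the proof goes through `FloorRatioLimit`.) -/
def RestrictionCocycle : Prop :=
  HexObservableLimit → ShortChordLocality → AdmissibleRestrictionLimit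

/-- **The restriction limit for the CANONICAL law `hexSAWLaw`** (`HexSAW.lean`: largest component
of the mesh graph of `D`, closed-segment edges) with floor-vertex endpoints: the probability that
the critical SAW of `D_δ` from `a δ` to `b δ` is a walk of the mesh graph of the hull subdomain `D'`
(all vertices in `D'`, all edge segments in `cl D'`) tends to `Φ'_A(0)^{5/8}`. -/
def FloorRestrictionLimit : Prop :=
  ∀ (D D' : DobrushinDomain) (ρ : ℝ) (φ : ConformalEquiv upperHalfPlaneSet D.carrier)
    (Φ : ConformalEquiv (upperHalfPlaneSet \ φ.pullbackHull D') upperHalfPlaneSet) (d : ℝ)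
    (a b : ℝ → HexVertex),
    IsFloorDomain D ρ → D.IsHullSubdomain D' → D.IsChordalUniformizing φ →
    IsRestrictionMap (φ.pullbackHull D') Φ → HasRestrictionDeriv (φ.pullbackHull D') Φ d →
    IsFloorEndpointApprox D a b →
    Tendsto (fun δ : ℝ => ((hexSAWLaw D.carrier δ (a δ) (b δ))
        {γ | (∀ v ∈ γ.walk.support, v ∈ embMeshVertices hexCenter D'.carrier δ) ∧
          ∀ e ∈ γ.walk.darts,
            (embMeshGraph hexGraph hexCenter D'.carrier δ).Adj e.fst e.snd}).toReal)
      (𝓝[>] 0) (𝓝 (d ^ ((5 : ℝ) / 8)))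

/-- **STUB 4 statement**: admissible world ⟹ canonical law. -/
def CanonicalTransfer : Prop :=
  AdmissibleRestrictionLimit → FloorRestrictionLimit

/-- **STUB 5 statement — range → chordal simple curve.**  Given the restriction limits, every
subsequential limit law (probability) of the critical hexagonal SAW curves in a floor domain with
floor-vertex endpoints is carried by the chordal carrier of `(D; a, b)`: simple curve classes from
`a` to `b` with trace in `D ∪ {a, b}`. -/
def ChordalCarrierOfLimits : Prop :=
  FloorRestrictionLimit →
    ∀ (D : DobrushinDomain) (ρ : ℝ) (a b : ℝ → HexVertex),
      IsFloorDomain D ρ → IsFloorEndpointApprox D a b →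
      ∀ μ : Measure (CurveClass ℂ), IsProbabilityMeasure μ →
        IsSubseqLimitLaw (fun δ (γ : HexDomainSAW D.carrier δ (a δ) (b δ)) => γ.curve)
          (fun δ => hexSAWLaw D.carrier δ (a δ) (b δ)) μ →
        ∀ᵐ c ∂μ, c ∈ chordalCarrier D

/-- **STUB 6 statement — LSW closing from lattice restriction limits** (any Dobrushin domain):
a subsequential limit law of the critical hexagonal SAW curves which is carried by the chordal
carrier and whose lattice hull-avoidance probabilities tend to `Φ'_A(0)^{5/8}` for EVERY hull
subdomain `D' = φ(ℍ ∖ A)` is the chordal SLE(8/3) law of `(D; a, b)` ([LSW03] Lemma 3.2 + Thm 6.1,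
transposed: `CurveClass.Measure.ext_of_missCode_injOn`, `injOn_missCode_imageTest`,
`IsSLELaw.hullRestriction_eightThirds_holds`, `HasRestrictionDeriv.tendsto_of_kernel_holds`). -/
def RestrictionIdentifies : Prop :=
  ∀ (D : DobrushinDomain) (a b : ℝ → HexVertex) (μ : Measure (CurveClass ℂ)),
    IsEmbEndpointApprox hexGraph hexCenter D a b → IsProbabilityMeasure μ →
    IsSubseqLimitLaw (fun δ (γ : HexDomainSAW D.carrier δ (a δ) (b δ)) => γ.curve)
      (fun δ => hexSAWLaw D.carrier δ (a δ) (b δ)) μ →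
    (∀ᵐ c ∂μ, c ∈ chordalCarrier D) →
    (∀ (D' : DobrushinDomain) (φ : ConformalEquiv upperHalfPlaneSet D.carrier)
        (Φ : ConformalEquiv (upperHalfPlaneSet \ φ.pullbackHull D') upperHalfPlaneSet) (d : ℝ),
        D.IsHullSubdomain D' → D.IsChordalUniformizing φ →
        IsRestrictionMap (φ.pullbackHull D') Φ → HasRestrictionDeriv (φ.pullbackHull D') Φ d →
        Tendsto (fun δ : ℝ => ((hexSAWLaw D.carrier δ (a δ) (b δ))
            {γ | (∀ v ∈ γ.walk.support, v ∈ embMeshVertices hexCenter D'.carrier δ) ∧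
              ∀ e ∈ γ.walk.darts,
                (embMeshGraph hexGraph hexCenter D'.carrier δ).Adj e.fst e.snd}).toReal)
          (𝓝[>] 0) (𝓝 (d ^ ((5 : ℝ) / 8)))) →
    IsSLELaw ((8 : ℝ≥0) / 3) D μ

/-- **Identification on the floor class** (what stubs 1–6 deliver). -/
def FloorIdentification : Prop :=
  ∀ (D : DobrushinDomain) (ρ : ℝ) (a b : ℝ → HexVertex),
    IsFloorDomain D ρ → IsFloorEndpointApprox D a b →
    ∀ μ : Measure (CurveClass ℂ), IsProbabilityMeasure μ →
      IsSubseqLimitLaw (fun δ (γ : HexDomainSAW D.carrier δ (a δ) (b δ)) => γ.curve)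
        (fun δ => hexSAWLaw D.carrier δ (a δ) (b δ)) μ →
      IsSLELaw ((8 : ℝ≥0) / 3) D μ

/-- **Identification everywhere** — verbatim the right-hand side of
`observableToSLE_iff_identification` after its two route hypotheses. -/
def FullIdentification : Prop :=
  ∀ (D : DobrushinDomain) (a b : ℝ → HexVertex),
    IsEmbEndpointApprox hexGraph hexCenter D a b →
    ∀ μ : Measure (CurveClass ℂ), IsProbabilityMeasure μ →
      IsSubseqLimitLaw (fun δ (γ : HexDomainSAW D.carrier δ (a δ) (b δ)) => γ.curve)
        (fun δ => hexSAWLaw D.carrier δ (a δ) (b δ)) μ →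
      IsSLELaw ((8 : ℝ≥0) / 3) D μ

/-- **STUB 7 statement — W2, the boundary-class / endpoint extension** (shared residue of every
line on this crux; the route hypotheses are available to it). -/
def DomainExtension : Prop :=
  HexObservableLimit → HexTight → FloorIdentification → FullIdentification

/-! ## Registered stubs

Every stub is stated over TREE vocabulary only (route decls `HexObservableLimit`, `HexTight` and
Literature notions), i.e. with the line's waypoint definitions above UNFOLDED, so that a worker's
landed file `Theorems/SAWDevelopingMapObservableToSLE<Stub>.lean` can state the registered signature
verbatim without re-declaring any `def` (pure proof files, kernel-reviewed lane); the `example`s after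
each stub check that the unfolded signature is definitionally the named waypoint implication used by
the composition. -/

/-- STUB 1 — `TargetTransport = HexObservableLimit → FloorRatioLimit` (size M–L; provable now —
triagers 1–3 checked it clause by clause; rev-4 form).  Two instances of the repaired
`HexObservableLimit`: `(D, ρ, Λ, ![m₀, m], a, b, Φ, L, Lb, ψ)` and
`(D', ρ, Λ, ![m₀, m'], a, b', Φ − x₀, L, Lb', ψ)` where `x₀ ∈ ℝ` is the boundary value of `Φ` at the
flat point `D'.pt 1` (exists: `L → Lb'` bounds `Φ' = e^L` on the convex half-disc `D ∩ B(b', ρ')`,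
so `Φ` is Lipschitz there and extends continuously; the value is real because a limit value in `ℍ`
would pull `b' ∈ ∂D` back into `D` by continuity of `Φ⁻¹`); `Φ − x₀` is again a `ConformalEquiv`
onto `ℍ` (real translation), `‖Φ − x₀‖ → ∞` at `a`, boundary value `0` at `b'`, same derivative hence
the same `L`; one bump `ψ` with `∫ ψ e^{(5/8)L} ≠ 0` (exists since `e^{(5/8)L}` is continuous and
nowhere zero on the open set `D`: test-function lemma `eq_zero_of_forall_integral` of
`BoundaryClosureNegative_Endgame`); the numerators `δ²Σψ F_δ` agree, are eventually `≠ 0` (nonzero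
limit), divide the two limits (`Filter.Tendsto.div`, `c ≠ 0`).
Sources: DuminilCopinSmirnov2012 Conj. 2 (arXiv:1007.0575 p. 7); KennedyLawler2013 (lattice
boundary factors are local — consistent). -/
theorem stub_targetTransport : HexObservableLimit →
  ∀ (D D' : DobrushinDomain) (ρ : ℝ) (Λ : ℝ → Finset HexVertex) (m₀ m m' : ℝ → ℤ)
  (a b b' : ℝ → Sym2 HexVertex) (Φ : ConformalEquiv D.carrier upperHalfPlaneSet)
  (L : ℂ → ℂ) (Lb Lb' : ℂ),
  D'.carrier = D.carrier → D'.pt 0 = D.pt 0 → 0 < ρ →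
  D.carrier ∩ ball (D.pt 0) ρ = {z : ℂ | (D.pt 0).im < z.im} ∩ ball (D.pt 0) ρ →
  D.carrier ∩ ball (D.pt 1) ρ = {z : ℂ | (D.pt 1).im < z.im} ∩ ball (D.pt 1) ρ →
  D.carrier ∩ ball (D'.pt 1) ρ = {z : ℂ | (D'.pt 1).im < z.im} ∩ ball (D'.pt 1) ρ →
  (∀ᶠ δ : ℝ in 𝓝[>] 0,
  hexDomainSimplyConnected (Λ δ) ∧ a δ ∈ hexDomainBoundary (Λ δ) ∧
  b δ ∈ hexDomainBoundary (Λ δ) ∧ b' δ ∈ hexDomainBoundary (Λ δ) ∧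
  Nonempty (HexMidEdgeSAW (Λ δ) (a δ) (b δ)) ∧ Nonempty (HexMidEdgeSAW (Λ δ) (a δ) (b' δ)) ∧
  (hexGraph.induce (↑(Λ δ) : Set HexVertex)).Preconnected ∧
  (∀ v ∈ Λ δ, (δ : ℂ) * hexCenter v ∈ D.carrier) ∧
  (∀ v : HexVertex, (δ : ℂ) * hexCenter v ∈ ball (D.pt 0) ρ → (v ∈ Λ δ ↔ m₀ δ ≤ v.1 1)) ∧
  (∀ v : HexVertex, (δ : ℂ) * hexCenter v ∈ ball (D.pt 1) ρ → (v ∈ Λ δ ↔ m δ ≤ v.1 1)) ∧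
  (∀ v : HexVertex, (δ : ℂ) * hexCenter v ∈ ball (D'.pt 1) ρ → (v ∈ Λ δ ↔ m' δ ≤ v.1 1))) →
  (∀ K : Set ℂ, IsCompact K → K ⊆ D.carrier →
  ∀ᶠ δ : ℝ in 𝓝[>] 0, ∀ v : HexVertex, (δ : ℂ) * hexCenter v ∈ K → v ∈ Λ δ) →
  Tendsto (fun δ : ℝ => (δ : ℂ) * hexMidpoint (a δ)) (𝓝[>] 0) (𝓝 (D.pt 0)) →
  Tendsto (fun δ : ℝ => (δ : ℂ) * hexMidpoint (b δ)) (𝓝[>] 0) (𝓝 (D.pt 1)) →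
  Tendsto (fun δ : ℝ => (δ : ℂ) * hexMidpoint (b' δ)) (𝓝[>] 0) (𝓝 (D'.pt 1)) →
  Tendsto (fun x => ‖Φ x‖) (𝓝[D.carrier] (D.pt 0)) atTop →
  Φ.HasBoundaryValue (D.pt 1) 0 →
  ContinuousOn L D.carrier → (∀ z ∈ D.carrier, Complex.exp (L z) = deriv Φ z) →
  Tendsto L (𝓝[D.carrier] (D.pt 1)) (𝓝 Lb) → Tendsto L (𝓝[D.carrier] (D'.pt 1)) (𝓝 Lb') →
  Tendsto (fun δ : ℝ =>
      hexParafermionicObservable (Λ δ) (a δ) hexCriticalFugacity (5 / 8) (b' δ) /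
        hexParafermionicObservable (Λ δ) (a δ) hexCriticalFugacity (5 / 8) (b δ)) (𝓝[>] 0)
    (𝓝 (Complex.exp ((5 / 8 : ℂ) * (Lb' - Lb)))) := by
  sorry

example : TargetTransport := stub_targetTransport

/-- STUB 2 — `ShortChordLocality` (size L–XL; OPEN — the anchor and load-bearing SAW estimate of
the line; no RSW/FKG for SAW).  Tools in the tree: DCS strip identity and positivity
(`SAW.HV.boundary_sum`, `DuminilCopinSmirnov2012_lemma2_holds`: `A_T ≤ 1/cos(3π/8)`), bridge decay
`B_T(x_c) → 0` (`GlazmanManolescu2019_prop11_limit_holds` = BBDDG14 Thm 10), unfolding / surgery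
(`SAWUnfolding`, `SAWSurgery`, DuminilCopinHammond2013), Kesten patterns; the 135°-window
positivity of the card (`Σ_e Z_U(a→e) ≤ C₀` for boxes with exit window `< 480°`) gives uniform
exit-mass bounds for half-boxes.  Predicted size of the excursion term `(n/Kn)²` (boundary
two-leg exponent 2) against a needed `o(1)`; an over-count at a cut point loses `δ^{-25/48}`, so
the proof must be a genuine unfolding/track-exchange estimate, not submultiplicativity.
Cheapest falsifier: transfer-matrix arches (triager 3's kit jobs j006927/8: consistent to R ≈ 6).
Free sub-case: for each FIXED span `n` the statement is the tail of a convergent series (DCS Lemma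
2); the content is uniformity of `K` in `n`. -/
theorem stub_shortChordLocality :
  ∀ ε : ℝ, 0 < ε → ∃ K : ℝ, 0 < K ∧ ∀ (n : ℕ), 1 ≤ n → ∀ (Λ : Finset HexVertex)
  (s t : Sym2 HexVertex), hexDomainSimplyConnected Λ →
  s ∈ hexDomainBoundary Λ → t ∈ hexDomainBoundary Λ → s ≠ t →
  dist (hexMidpoint s) (hexMidpoint t) ≤ n →
  (hexMidpoint t).im = (hexMidpoint s).im →
  (∀ v ∈ Λ, (hexMidpoint s).im < (hexCenter v).im) →
  (∀ v : HexVertex, (hexMidpoint s).im < (hexCenter v).im →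
  dist (hexCenter v) (hexMidpoint s) ≤ 2 * K * n → v ∈ Λ) →
  (∑ γ : HexMidEdgeSAW Λ s t,
  if ∃ v ∈ γ.verts, K * n ≤ dist (hexCenter v) (hexMidpoint s)
  then hexCriticalFugacity ^ γ.length else 0) ≤
  ε * ∑ γ : HexMidEdgeSAW Λ s t, hexCriticalFugacity ^ γ.length := by
  sorry

example : ShortChordLocality := stub_shortChordLocality

/-- STUB 3 — `RestrictionCocycle = HexObservableLimit → ShortChordLocality →
AdmissibleRestrictionLimit` (size L; the mechanism).  Target transport is CONSUMED through the
landed theorem of stub 1 (`FloorRatioLimit`; the registered signature takes `HexObservableLimit`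
itself only to stay self-contained under the registry's size bound).  For a floor point `s` near
`a` (floor mid-edges `s δ → s` inside `B(a, ρ)`, boundary edges of both `Λ δ` and `Λ' δ`, which agree
there): `r_ab = [Z_{Λ'}(a,b)/Z_{Λ'}(a,s)]·[Z_Λ(a,s)/Z_Λ(a,b)]·r_as` with
`r_pq := Z_{Λ'}(p,q)/Z_Λ(p,q) ∈ [0,1]` (exact restriction: `HexMidEdgeSAW Λ' ↪ HexMidEdgeSAW Λ`,
weights `≥ 0`).  The two brackets tend, by `FloorRatioLimit` applied to `(D; a; b, s)` with
`Φ_D = J ∘ φ⁻¹` (`J w = −1/w`) and to `(D'; a; b, s)` with `Φ_{D'} = J ∘ Φ_A ∘ φ⁻¹` (radius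
`ρ − |s − a|`; moduli: deterministic floor-to-floor winding `∓π`, tree `HV.pturn_of_isAlphaDart`;
`L` has limits at flat points by Schwarz reflection; re-marking `pt 1 := s` of the same Jordan
curve), to `R(s) = |Φ_{D'}'(b)Φ_D'(s) / (Φ_{D'}'(s)Φ_D'(b))|^{5/8}`; and `R(s) → d^{5/8}` as
`s → a` (`Φ_{D'}'/Φ_D' = c·Φ_A'(w) w²/Φ_A(w)²`, `→ c` at `w = ∞` (i.e. at `b`) since `Φ_A(w) ∼ w`,
`→ c/d` at `w → 0` since `Φ_A(w) ∼ d w`).  `1 − r_as ≤ P_Λ(γ_{a→s}` has a vertex outside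
`B(a, ρ')) ≤ ε` by `ShortChordLocality` (`Λ δ` is above its floor row and contains the half-box;
`K = ρ'/(2|s−a|)`), so `limsup/liminf_δ r_ab ∈ [R(s)(1−ε(s)), R(s)]`, `ε(s) → 0`.
Sources: LawlerSchrammWerner2003 (Thm 6.1, §2), LawlerSchrammWerner2004SAW (§3.4, Prop. 2),
Lawler2005 §0.3 ("SAW satisfies restriction"), arXiv:1109.3091 / arXiv:1008.4321 §3.1. -/
theorem stub_restrictionCocycle : HexObservableLimit →
    (∀ ε : ℝ, 0 < ε → ∃ K : ℝ, 0 < K ∧ ∀ (n : ℕ), 1 ≤ n → ∀ (Λ : Finset HexVertex) (s t : Sym2 HexVertex), hexDomainSimplyConnected Λ → s ∈ hexDomainBoundary Λ → t ∈ hexDomainBoundary Λ → s ≠ t → dist (hexMidpoint s) (hexMidpoint t) ≤ n → (hexMidpoint t).im = (hexMidpoint s).im → (∀ v ∈ Λ, (hexMidpoint s).im < (hexCenter v).im) → (∀ v : HexVertex, (hexMidpoint s).im < (hexCenter v).im → dist (hexCenter v) (hexMidpoint s) ≤ 2 * K * n → v ∈ Λ) → (∑ γ : HexMidEdgeSAW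 Λ s t, if ∃ v ∈ γ.verts, K * n ≤ dist (hexCenter v) (hexMidpoint s) then hexCriticalFugacity ^ γ.length else 0) ≤ ε * ∑ γ : HexMidEdgeSAW Λ s t, hexCriticalFugacity ^ γ.length) →
  ∀ (D D' : DobrushinDomain) (ρ : ℝ) (φ : ConformalEquiv upperHalfPlaneSet D.carrier)
  (Φ : ConformalEquiv (upperHalfPlaneSet \ φ.pullbackHull D') upperHalfPlaneSet) (d : ℝ)
  (Λ Λ' : ℝ → Finset HexVertex) (m : ℝ → ℤ) (a b : ℝ → Sym2 HexVertex),
  (0 < ρ ∧ (D.pt 1).im = (D.pt 0).im ∧ D.carrier ⊆ {z : ℂ | (D.pt 0).im < z.im} ∧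
  D.carrier ∩ ball (D.pt 0) ρ = {z : ℂ | (D.pt 0).im < z.im} ∩ ball (D.pt 0) ρ ∧
  D.carrier ∩ ball (D.pt 1) ρ = {z : ℂ | (D.pt 1).im < z.im} ∩ ball (D.pt 1) ρ) → D.IsHullSubdomain D' → D.IsChordalUniformizing φ →
  IsRestrictionMap (φ.pullbackHull D') Φ → HasRestrictionDeriv (φ.pullbackHull D') Φ d →
  (∀ᶠ δ : ℝ in 𝓝[>] 0,
  Λ' δ ⊆ Λ δ ∧ hexDomainSimplyConnected (Λ δ) ∧ hexDomainSimplyConnected (Λ' δ) ∧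
  (hexGraph.induce (↑(Λ δ) : Set HexVertex)).Preconnected ∧
  (hexGraph.induce (↑(Λ' δ) : Set HexVertex)).Preconnected ∧
  a δ ∈ hexDomainBoundary (Λ δ) ∧ b δ ∈ hexDomainBoundary (Λ δ) ∧
  a δ ∈ hexDomainBoundary (Λ' δ) ∧ b δ ∈ hexDomainBoundary (Λ' δ) ∧
  Nonempty (HexMidEdgeSAW (Λ' δ) (a δ) (b δ)) ∧
  (∀ v ∈ Λ δ, (δ : ℂ) * hexCenter v ∈ D.carrier ∧ m δ ≤ v.1 1) ∧
  (∀ v ∈ Λ' δ, (δ : ℂ) * hexCenter v ∈ D'.carrier) ∧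
  (∀ v : HexVertex, (δ : ℂ) * hexCenter v ∈ ball (D.pt 0) ρ ∪ ball (D.pt 1) ρ →
  ((v ∈ Λ δ ↔ m δ ≤ v.1 1) ∧ (v ∈ Λ' δ ↔ m δ ≤ v.1 1)))) →
  (∀ K : Set ℂ, IsCompact K → K ⊆ D.carrier →
  ∀ᶠ δ : ℝ in 𝓝[>] 0, ∀ v : HexVertex, (δ : ℂ) * hexCenter v ∈ K → v ∈ Λ δ) →
  (∀ K : Set ℂ, IsCompact K → K ⊆ D'.carrier →
  ∀ᶠ δ : ℝ in 𝓝[>] 0, ∀ v : HexVertex, (δ : ℂ) * hexCenter v ∈ K → v ∈ Λ' δ) →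
  Tendsto (fun δ : ℝ => (δ : ℂ) * hexMidpoint (a δ)) (𝓝[>] 0) (𝓝 (D.pt 0)) →
  Tendsto (fun δ : ℝ => (δ : ℂ) * hexMidpoint (b δ)) (𝓝[>] 0) (𝓝 (D.pt 1)) →
  Tendsto (fun δ : ℝ => (∑ γ : HexMidEdgeSAW (Λ' δ) (a δ) (b δ), hexCriticalFugacity ^ γ.length) /
  (∑ γ : HexMidEdgeSAW (Λ δ) (a δ) (b δ), hexCriticalFugacity ^ γ.length)) (𝓝[>] 0)
  (𝓝 (d ^ ((5 : ℝ) / 8))) := by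
  sorry

example : RestrictionCocycle := stub_restrictionCocycle

/-- STUB 4 — `CanonicalTransfer = AdmissibleRestrictionLimit → FloorRestrictionLimit` (size L;
discretisation glue "K3(i)" flagged by the panel).  From the canonical `D_δ` (largest mesh
component) build admissible families: drop the pendant bottom row (case
`frac(2h/√3δ) ∈ [1/3, 2/3)`), fill microscopic holes (isolated vertices whose three edge segments
leave `cl D`), take `m δ` = the first row above the floor, check exhaustion of compacts / main
component contains the bulk; vertex SAWs of `D_δ` between floor vertices = mid-edge SAWs between
the vertical boundary mid-edges below them (same `x_c^{#vertices}`); canonical SAWs ⊆ admissible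
SAWs, and the difference (walks through a filled hole or across a bad edge, all within `δ` of
`∂D ∖ (B(a,η) ∪ B(b,η))`) has probability `→ 0` by the admissible cocycle itself applied to thin
collar hulls `A_η` over `[−R,−r] ∪ [r,R]` (`Φ'_{A_η}(0) → 1`, `tendsto_of_kernel_holds`; Jordan hull
subdomains for arc hulls: `exists_isHullSubdomain_pullbackHull_eq`).  Sources: DCS §4 (canonical
`Ω_δ`), `HexSAW.lean` conventions, `finite_hexDomainSAW` / `isProbabilityMeasure_hexSAWLaw_of_reachable`
(Negative/Identification). -/
theorem stub_canonicalTransfer :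
    (
    ∀ (D D' : DobrushinDomain) (ρ : ℝ) (φ : ConformalEquiv upperHalfPlaneSet D.carrier)
    (Φ : ConformalEquiv (upperHalfPlaneSet \ φ.pullbackHull D') upperHalfPlaneSet) (d : ℝ)
    (Λ Λ' : ℝ → Finset HexVertex) (m : ℝ → ℤ) (a b : ℝ → Sym2 HexVertex),
    (0 < ρ ∧ (D.pt 1).im = (D.pt 0).im ∧ D.carrier ⊆ {z : ℂ | (D.pt 0).im < z.im} ∧
    D.carrier ∩ ball (D.pt 0) ρ = {z : ℂ | (D.pt 0).im < z.im} ∩ ball (D.pt 0) ρ ∧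
    D.carrier ∩ ball (D.pt 1) ρ = {z : ℂ | (D.pt 1).im < z.im} ∩ ball (D.pt 1) ρ) → D.IsHullSubdomain D' → D.IsChordalUniformizing φ →
    IsRestrictionMap (φ.pullbackHull D') Φ → HasRestrictionDeriv (φ.pullbackHull D') Φ d →
    (∀ᶠ δ : ℝ in 𝓝[>] 0,
    Λ' δ ⊆ Λ δ ∧ hexDomainSimplyConnected (Λ δ) ∧ hexDomainSimplyConnected (Λ' δ) ∧
    (hexGraph.induce (↑(Λ δ) : Set HexVertex)).Preconnected ∧
    (hexGraph.induce (↑(Λ' δ) : Set HexVertex)).Preconnected ∧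
    a δ ∈ hexDomainBoundary (Λ δ) ∧ b δ ∈ hexDomainBoundary (Λ δ) ∧
    a δ ∈ hexDomainBoundary (Λ' δ) ∧ b δ ∈ hexDomainBoundary (Λ' δ) ∧
    Nonempty (HexMidEdgeSAW (Λ' δ) (a δ) (b δ)) ∧
    (∀ v ∈ Λ δ, (δ : ℂ) * hexCenter v ∈ D.carrier ∧ m δ ≤ v.1 1) ∧
    (∀ v ∈ Λ' δ, (δ : ℂ) * hexCenter v ∈ D'.carrier) ∧
    (∀ v : HexVertex, (δ : ℂ) * hexCenter v ∈ ball (D.pt 0) ρ ∪ ball (D.pt 1) ρ →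
    ((v ∈ Λ δ ↔ m δ ≤ v.1 1) ∧ (v ∈ Λ' δ ↔ m δ ≤ v.1 1)))) →
    (∀ K : Set ℂ, IsCompact K → K ⊆ D.carrier →
    ∀ᶠ δ : ℝ in 𝓝[>] 0, ∀ v : HexVertex, (δ : ℂ) * hexCenter v ∈ K → v ∈ Λ δ) →
    (∀ K : Set ℂ, IsCompact K → K ⊆ D'.carrier →
    ∀ᶠ δ : ℝ in 𝓝[>] 0, ∀ v : HexVertex, (δ : ℂ) * hexCenter v ∈ K → v ∈ Λ' δ) →
    Tendsto (fun δ : ℝ => (δ : ℂ) * hexMidpoint (a δ)) (𝓝[>] 0) (𝓝 (D.pt 0)) →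
    Tendsto (fun δ : ℝ => (δ : ℂ) * hexMidpoint (b δ)) (𝓝[>] 0) (𝓝 (D.pt 1)) →
    Tendsto (fun δ : ℝ => (∑ γ : HexMidEdgeSAW (Λ' δ) (a δ) (b δ), hexCriticalFugacity ^ γ.length) /
    (∑ γ : HexMidEdgeSAW (Λ δ) (a δ) (b δ), hexCriticalFugacity ^ γ.length)) (𝓝[>] 0)
    (𝓝 (d ^ ((5 : ℝ) / 8)))) →
  ∀ (D D' : DobrushinDomain) (ρ : ℝ) (φ : ConformalEquiv upperHalfPlaneSet D.carrier)
  (Φ : ConformalEquiv (upperHalfPlaneSet \ φ.pullbackHull D') upperHalfPlaneSet) (d : ℝ)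
  (a b : ℝ → HexVertex),
  (0 < ρ ∧ (D.pt 1).im = (D.pt 0).im ∧ D.carrier ⊆ {z : ℂ | (D.pt 0).im < z.im} ∧
  D.carrier ∩ ball (D.pt 0) ρ = {z : ℂ | (D.pt 0).im < z.im} ∩ ball (D.pt 0) ρ ∧
  D.carrier ∩ ball (D.pt 1) ρ = {z : ℂ | (D.pt 1).im < z.im} ∩ ball (D.pt 1) ρ) → D.IsHullSubdomain D' → D.IsChordalUniformizing φ →
  IsRestrictionMap (φ.pullbackHull D') Φ → HasRestrictionDeriv (φ.pullbackHull D') Φ d →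
  (IsEmbEndpointApprox hexGraph hexCenter D a b ∧ ∀ᶠ δ : ℝ in 𝓝[>] 0,
  (∃ u : HexVertex, hexGraph.Adj (a δ) u ∧ ((δ : ℂ) * hexCenter u).im ≤ (D.pt 0).im) ∧
  (∃ u : HexVertex, hexGraph.Adj (b δ) u ∧ ((δ : ℂ) * hexCenter u).im ≤ (D.pt 1).im)) →
  Tendsto (fun δ : ℝ => ((hexSAWLaw D.carrier δ (a δ) (b δ))
  {γ | (∀ v ∈ γ.walk.support, v ∈ embMeshVertices hexCenter D'.carrier δ) ∧
  ∀ e ∈ γ.walk.darts,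
  (embMeshGraph hexGraph hexCenter D'.carrier δ).Adj e.fst e.snd}).toReal)
  (𝓝[>] 0) (𝓝 (d ^ ((5 : ℝ) / 8))) := by
  sorry

example : CanonicalTransfer := stub_canonicalTransfer

/-- STUB 5 — `ChordalCarrierOfLimits` (size L; the simplicity half is OPEN — "range → curve",
shared with the sibling cards' NoRetrace/NoParallelStrands).  Endpoints: `IsEmbEndpointApprox`
(`source/target` of the limit class are `a`, `b`: cf. Negative/EndpointNecessity).  Boundary
avoidance away from `a, b`: `μ(range meets frontierPiece_k) ≤ liminf P_δ(γ ⊄ D'_δ)` for hull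
subdomains `D'` removing a thin collar at that piece, `= 1 − Φ'_A(0)^{5/8} → 0` as the collar
flattens.  Simplicity (`CurveClass.simple`): uniform limits of simple polylines fail to be simple
only through ε-parallel macroscopic double strands (retracing fjords); expected tool: strip
subcriticality of `x_c`-bridges (`E_T = 0`, `B_T → 0`, `SAWStripTM*`) + unfolding surgery giving
`exp(−c L/w)` for two strands of length `L` at width `w`.  Sources: RohdeSchramm2005 (SLE(8/3)
simple — consistency), DuminilCopinHammond2013, KemppainenSmirnov2017 §1. -/
theorem stub_chordalCarrier :
    (
    ∀ (D D' : DobrushinDomain) (ρ : ℝ) (φ : ConformalEquiv upperHalfPlaneSet D.carrier)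
    (Φ : ConformalEquiv (upperHalfPlaneSet \ φ.pullbackHull D') upperHalfPlaneSet) (d : ℝ)
    (a b : ℝ → HexVertex),
    (0 < ρ ∧ (D.pt 1).im = (D.pt 0).im ∧ D.carrier ⊆ {z : ℂ | (D.pt 0).im < z.im} ∧
    D.carrier ∩ ball (D.pt 0) ρ = {z : ℂ | (D.pt 0).im < z.im} ∩ ball (D.pt 0) ρ ∧
    D.carrier ∩ ball (D.pt 1) ρ = {z : ℂ | (D.pt 1).im < z.im} ∩ ball (D.pt 1) ρ) → D.IsHullSubdomain D' → D.IsChordalUniformizing φ →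
    IsRestrictionMap (φ.pullbackHull D') Φ → HasRestrictionDeriv (φ.pullbackHull D') Φ d →
    (IsEmbEndpointApprox hexGraph hexCenter D a b ∧ ∀ᶠ δ : ℝ in 𝓝[>] 0,
    (∃ u : HexVertex, hexGraph.Adj (a δ) u ∧ ((δ : ℂ) * hexCenter u).im ≤ (D.pt 0).im) ∧
    (∃ u : HexVertex, hexGraph.Adj (b δ) u ∧ ((δ : ℂ) * hexCenter u).im ≤ (D.pt 1).im)) →
    Tendsto (fun δ : ℝ => ((hexSAWLaw D.carrier δ (a δ) (b δ))
    {γ | (∀ v ∈ γ.walk.support, v ∈ embMeshVertices hexCenter D'.carrier δ) ∧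
    ∀ e ∈ γ.walk.darts,
    (embMeshGraph hexGraph hexCenter D'.carrier δ).Adj e.fst e.snd}).toReal)
    (𝓝[>] 0) (𝓝 (d ^ ((5 : ℝ) / 8)))) →
    ∀ (D : DobrushinDomain) (ρ : ℝ) (a b : ℝ → HexVertex),
      (0 < ρ ∧ (D.pt 1).im = (D.pt 0).im ∧ D.carrier ⊆ {z : ℂ | (D.pt 0).im < z.im} ∧
      D.carrier ∩ ball (D.pt 0) ρ = {z : ℂ | (D.pt 0).im < z.im} ∩ ball (D.pt 0) ρ ∧
      D.carrier ∩ ball (D.pt 1) ρ = {z : ℂ | (D.pt 1).im < z.im} ∩ ball (D.pt 1) ρ) → (IsEmbEndpointApprox hexGraph hexCenter D a b ∧ ∀ᶠ δ : ℝ in 𝓝[>] 0,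
      (∃ u : HexVertex, hexGraph.Adj (a δ) u ∧ ((δ : ℂ) * hexCenter u).im ≤ (D.pt 0).im) ∧
      (∃ u : HexVertex, hexGraph.Adj (b δ) u ∧ ((δ : ℂ) * hexCenter u).im ≤ (D.pt 1).im)) →
      ∀ μ : Measure (CurveClass ℂ), IsProbabilityMeasure μ →
        IsSubseqLimitLaw (fun δ (γ : HexDomainSAW D.carrier δ (a δ) (b δ)) => γ.curve)
          (fun δ => hexSAWLaw D.carrier δ (a δ) (b δ)) μ →
        ∀ᵐ c ∂μ, c ∈ chordalCarrier D := by
  sorry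

example : ChordalCarrierOfLimits := stub_chordalCarrier

/-- STUB 6 — `RestrictionIdentifies` (size L; tree glue, provable now).  Fix `φ`
(`MarkedDomain.exists_isChordalUniformizing_holds`) and an SLE(8/3) law `ν` of `D`
(`exists_isSLECurve_through` with `hasSLETrace_eightThirds`).  (i) Sandwich:
`{γ is a D'-mesh walk} ⊆ {curve ⊆ cl D'}` (closed, `isClosed_rangeSubset`) gives
`μ{⊆ cl D'} ≥ d'^{5/8}` by portmanteau; on the carrier `{⊆ cl D''} ⊆ {⊆ D' ∪ B(a,η) ∪ B(b,η)}`
(open) for `cl D'' ∩ D ⊆ D'` gives `μ{⊆ cl D''} ≤ d'^{5/8}`; inner/outer arc-hull approximation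
(`IsPlusHull.exists_antitone_isArcHull_holds`, `exists_isHullSubdomain_pullbackHull_eq`) and
`HasRestrictionDeriv.tendsto_of_kernel_holds` give `μ{⊆ cl D'} = Φ'_A(0)^{5/8} = ν{⊆ cl D'}`
(`HullRestrictionNull` + `sle_restriction_eightThirds_holds` for `ν`).  (ii) Transfer to equality
of laws exactly as in `LawlerSchrammWerner2003_unique_of_facts`:
`CurveClass.Measure.ext_of_missCode_injOn` with `injOn_missCode_imageTest`, avoidance of image test
sets = containment in the hull subdomain of their fill (`RestrictionConfig.disjoint_hpFill_iff`,
`measure_rangeSubset_compl_image_eq(_zero)`).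
Sources: LawlerSchrammWerner2003 Lemma 3.2, Prop. 3.3, Thm 6.1 (arXiv:math/0209343 pp. 10–11, 23). -/
theorem stub_restrictionIdentifies :
  ∀ (D : DobrushinDomain) (a b : ℝ → HexVertex) (μ : Measure (CurveClass ℂ)),
  IsEmbEndpointApprox hexGraph hexCenter D a b → IsProbabilityMeasure μ →
  IsSubseqLimitLaw (fun δ (γ : HexDomainSAW D.carrier δ (a δ) (b δ)) => γ.curve)
  (fun δ => hexSAWLaw D.carrier δ (a δ) (b δ)) μ →
  (∀ᵐ c ∂μ, c ∈ chordalCarrier D) →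
  (∀ (D' : DobrushinDomain) (φ : ConformalEquiv upperHalfPlaneSet D.carrier)
  (Φ : ConformalEquiv (upperHalfPlaneSet \ φ.pullbackHull D') upperHalfPlaneSet) (d : ℝ),
  D.IsHullSubdomain D' → D.IsChordalUniformizing φ →
  IsRestrictionMap (φ.pullbackHull D') Φ → HasRestrictionDeriv (φ.pullbackHull D') Φ d →
  Tendsto (fun δ : ℝ => ((hexSAWLaw D.carrier δ (a δ) (b δ))
  {γ | (∀ v ∈ γ.walk.support, v ∈ embMeshVertices hexCenter D'.carrier δ) ∧
  ∀ e ∈ γ.walk.darts,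
  (embMeshGraph hexGraph hexCenter D'.carrier δ).Adj e.fst e.snd}).toReal)
  (𝓝[>] 0) (𝓝 (d ^ ((5 : ℝ) / 8)))) →
  IsSLELaw ((8 : ℝ≥0) / 3) D μ := by
  sorry

example : RestrictionIdentifies := stub_restrictionIdentifies

/-- STUB 7 — `DomainExtension = HexObservableLimit → HexTight → FloorIdentification →
FullIdentification` (size XL; OPEN — W2 of CruxAttack10472 / `flat_premise_false_on_unitDisc`,
the shared residue of all four restriction cards and of the martingale scheme alike; by
Disproof.lean v7 `extension_iff_crux_of_floor` it is EQUIVALENT to the crux given the floor part).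
From floor domains with floor-vertex endpoints to every Dobrushin domain and every
`IsEmbEndpointApprox`: (a) endpoints at bounded / mesoscopic height above the floor
(domain-Markov averaging over initial patterns + local insertion surgery is the card's proposal for
bounded height; mesoscopic height open); (b) non-convex / general FLAT-floored domains: exact
lattice restriction from a floor super-domain + `IsSLELaw.hullRestriction_eightThirds_holds`
(reachable layer); (c) marked points not on a common supporting line / rough prime ends: no tool
of this line applies (`HexObservableLimit` is silent on domains not flat at `a` or `b`,
Negative/HypothesisSilence, `flat_premise_false_on_unitDisc(_root)`).  Held by the lead. -/
theorem stub_domainExtension : HexObservableLimit → HexTight →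
    (
    ∀ (D : DobrushinDomain) (ρ : ℝ) (a b : ℝ → HexVertex),
    (0 < ρ ∧ (D.pt 1).im = (D.pt 0).im ∧ D.carrier ⊆ {z : ℂ | (D.pt 0).im < z.im} ∧
    D.carrier ∩ ball (D.pt 0) ρ = {z : ℂ | (D.pt 0).im < z.im} ∩ ball (D.pt 0) ρ ∧
    D.carrier ∩ ball (D.pt 1) ρ = {z : ℂ | (D.pt 1).im < z.im} ∩ ball (D.pt 1) ρ) → (IsEmbEndpointApprox hexGraph hexCenter D a b ∧ ∀ᶠ δ : ℝ in 𝓝[>] 0,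
    (∃ u : HexVertex, hexGraph.Adj (a δ) u ∧ ((δ : ℂ) * hexCenter u).im ≤ (D.pt 0).im) ∧
    (∃ u : HexVertex, hexGraph.Adj (b δ) u ∧ ((δ : ℂ) * hexCenter u).im ≤ (D.pt 1).im)) →
    ∀ μ : Measure (CurveClass ℂ), IsProbabilityMeasure μ →
    IsSubseqLimitLaw (fun δ (γ : HexDomainSAW D.carrier δ (a δ) (b δ)) => γ.curve)
    (fun δ => hexSAWLaw D.carrier δ (a δ) (b δ)) μ →
    IsSLELaw ((8 : ℝ≥0) / 3) D μ) →
  ∀ (D : DobrushinDomain) (a b : ℝ → HexVertex),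
  IsEmbEndpointApprox hexGraph hexCenter D a b →
  ∀ μ : Measure (CurveClass ℂ), IsProbabilityMeasure μ →
  IsSubseqLimitLaw (fun δ (γ : HexDomainSAW D.carrier δ (a δ) (b δ)) => γ.curve)
  (fun δ => hexSAWLaw D.carrier δ (a δ) (b δ)) μ →
  IsSLELaw ((8 : ℝ≥0) / 3) D μ := by
  sorry

example : DomainExtension := stub_domainExtension

/-! ## Composition (sorry-free) -/

/-- Stubs 1–6 identify every subsequential limit in the floor class, given `HexObservableLimit`
(consumed by stub 3 through the landed theorem of stub 1, which therefore enters this glue only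
nominally; `HexTight` is not needed here — subsequential limits are handed in). -/
theorem floorIdentification_of_parts (_h₁ : TargetTransport) (h₂ : ShortChordLocality)
    (h₃ : RestrictionCocycle) (h₄ : CanonicalTransfer) (h₅ : ChordalCarrierOfLimits)
    (h₆ : RestrictionIdentifies) (hO : HexObservableLimit) : FloorIdentification := by
  intro D ρ a b hD hab μ hμ hsub
  have hR : FloorRestrictionLimit := h₄ (h₃ hO h₂)
  exact h₆ D a b μ hab.1 hμ hsub (h₅ hR D ρ a b hD hab μ hμ hsub)
    (fun D' φ Φ d hD' hφ hΦ hd => hR D D' ρ φ Φ d a b hD hD' hφ hΦ hd hab)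

/-- **The skeleton concludes the crux BY NAME.**  `ObservableToSLE` (route `SAWDevelopingMap`,
stmt-CriticalPhenomena-10472; the four other route copies are `Iff.rfl`) from the seven registered
stubs, through the landed identification lemma (Negative/Identification, p69742). -/
theorem ObservableToSLE_of :
    Summit.CriticalPhenomena.SAWScalingLimit.Theses.SAWDevelopingMap.ObservableToSLE := by
  refine Summit.CriticalPhenomena.SAWScalingLimit.Theorems.ObservableToSLE.Negative.observableToSLE_iff_identification.mpr ?_
  intro hO hT
  exact stub_domainExtension hO hT
    (floorIdentification_of_parts stub_targetTransport stub_shortChordLocality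
      stub_restrictionCocycle stub_canonicalTransfer stub_chordalCarrier
      stub_restrictionIdentifies hO)

end Summit.CriticalPhenomena.SAWScalingLimit.Cruxes.ObservableToSLE.FloorRatioRestrictionBootstrap

end
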